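import Mathlib
import Summits.Ventures.PercRepro2.TBAdm
import Summits.Ventures.PercRepro2.TB14OwnRootEdge

/-!
# Under the admissibility rule the edge from the mark to its own root never hurts
(blind cell PercRepro2, mine-c g20, 2026-08-25; `conjectures/MINE-C.md` §29.6)

Theorem T₁ (`TB14OwnRootEdge`) writes the defect of the edge `b a₁` as `A + J`, the counts of the
two-colour `a₂`-avoidance of the mark and of the anchor status `Mr` of the mark.  Both are admissible
systems of (TB-ADM′) (`TBAdm.lean`) on the single vertex `b`: the avoidance constraint `∉ M_r ∧ ∉ M_b`
(an `a₂`-avoidance, accompanied) and `∈ M_r ∧ ∉ M_b ∧ ∉ K_b` (the exclusion `∉ K_b` accompanied by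
`∈ M_r`).  So (`pairCount_foldK_le_ownRootEdge_of_TBAdm`) under the candidate (TB-ADM′)

  `D(G − b a₁) ≤ D(G)`   at every profile in which `b a₁` is free —

with Theorems P (`b o`) and Q (`b a₂`) unconditional, every marked edge at the mark deletes under the
rule; the unmarked edge `b z` is the open global case (§28.2).  A CONDITIONAL theorem (hypothesis
`TBAdm R`, a candidate of one seat).  Own work; standard axioms.
-/

namespace Summit.Ventures.PercRepro2

namespace TB14Cut

open CovForm A3InactiveTyped FavCond

section OwnRootEdgeAdm

variable {V : Type} {E : Type} [Fintype V] [DecidableEq V] [Fintype E] [DecidableEq E]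
variable {R : Type*} [Field R] [LinearOrder R]
variable {ends : E → Sym2 V} {e : E} {a₁ a₂ b o : V}

/-- The constraint of the avoidance piece: the mark outside both clusters of `a₂`
(`∉ M_b`, `∉ M_r`; an `a₂`-avoidance). -/
def ownRootAvoidCon : AdmCon := ⟨false, false, false, true, false, true⟩

/-- The constraint of the anchor piece: the mark red at `a₂`, outside the blue cluster of `a₂` and
the blue cluster of `a₁` (`∈ M_r`, `∉ M_b`, `∉ K_b`). -/
def ownRootAnchorCon : AdmCon := ⟨false, true, false, true, true, false⟩

/-- The avoidance constraint carries no `a₁`-avoidance. -/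
lemma not_unaccKb_ownRootAvoidCon : ¬ ownRootAvoidCon.UnaccKb := fun h => by
  simp [AdmCon.UnaccKb, ownRootAvoidCon] at h

/-- The avoidance constraint is valid (its `a₂`-avoidance is accompanied by `∉ M_b`). -/
lemma valid_ownRootAvoidCon : ownRootAvoidCon.Valid :=
  ⟨fun h => absurd h not_unaccKb_ownRootAvoidCon, fun _ => rfl,
    fun h => not_unaccKb_ownRootAvoidCon h.1⟩

/-- The anchor constraint carries no `a₁`-avoidance (`∉ K_b` is accompanied by `∈ M_r`). -/
lemma not_unaccKb_ownRootAnchorCon : ¬ ownRootAnchorCon.UnaccKb := fun h => by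
  simp [AdmCon.UnaccKb, ownRootAnchorCon] at h

/-- The anchor constraint carries no `a₂`-avoidance. -/
lemma not_unaccMr_ownRootAnchorCon : ¬ ownRootAnchorCon.UnaccMr := fun h => by
  simp [AdmCon.UnaccMr, ownRootAnchorCon] at h

/-- The anchor constraint is valid. -/
lemma valid_ownRootAnchorCon : ownRootAnchorCon.Valid :=
  ⟨fun h => absurd h not_unaccKb_ownRootAnchorCon, fun h => absurd h not_unaccMr_ownRootAnchorCon,
    fun h => not_unaccKb_ownRootAnchorCon h.1⟩

omit [Fintype V] [DecidableEq V] [Fintype E] [DecidableEq E] in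
/-- The avoidance constraint alone is an admissible system. -/
lemma admSystem_ownRootAvoid : AdmSystem ({b} : Finset V) (fun _ => ownRootAvoidCon) :=
  ⟨fun _ _ => valid_ownRootAvoidCon, fun ⟨_, _, hv⟩ => absurd hv not_unaccKb_ownRootAvoidCon,
    fun _ _ _ => rfl⟩

omit [Fintype V] [DecidableEq V] [Fintype E] [DecidableEq E] in
/-- The anchor constraint alone is an admissible system. -/
lemma admSystem_ownRootAnchor : AdmSystem ({b} : Finset V) (fun _ => ownRootAnchorCon) :=
  ⟨fun _ _ => valid_ownRootAnchorCon, fun ⟨_, _, hv⟩ => absurd hv not_unaccKb_ownRootAnchorCon,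
    fun ⟨_, _, hv⟩ => absurd hv not_unaccMr_ownRootAnchorCon⟩

omit [Fintype V] [DecidableEq V] [Fintype E] [DecidableEq E] [LinearOrder R] in
/-- The avoidance piece is the admissible kernel of its constraint with the copies exchanged. -/
lemma admK_ownRootAvoid (y w : Config E) :
    (admK ends a₁ a₂ o {b} (fun _ => ownRootAvoidCon) y w : R) = ownRootAvoid ends a₁ a₂ b o w y := by
  simp only [admK, admInd, ownRootAvoid, ownRootAvoidCon, Finset.prod_singleton, Bool.false_eq_true,
    ↓reduceIte]
  ring

omit [Fintype V] [DecidableEq V] [Fintype E] [DecidableEq E] [LinearOrder R] in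
/-- The anchor piece is the admissible kernel of its constraint with the copies exchanged. -/
lemma admK_ownRootAnchor (y w : Config E) :
    (admK ends a₁ a₂ o {b} (fun _ => ownRootAnchorCon) y w : R) =
      ownRootAnchor ends a₁ a₂ b o w y := by
  simp only [admK, admInd, ownRootAnchor, ownRootAnchorCon, Finset.prod_singleton, Bool.false_eq_true,
    ↓reduceIte]
  ring

/-- **Under (TB-ADM′) the edge from the mark to its own root never hurts**:
`D(G − b a₁) ≤ D(G)` at every profile in which `b a₁` is free (Theorem T₁ + the two admissible
pieces). -/
theorem pairCount_foldK_le_ownRootEdge_of_TBAdm [IsStrictOrderedRing R] (h : TBAdm R)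
    (he : ends e = s(b, a₁)) (F : Finset E) (z : Config E) (heF : e ∈ F) :
    pairCount (F.erase e) (Function.update z e false)
        (foldK ends a₁ a₂ b o : Config E → Config E → R) ≤
      pairCount F z (foldK ends a₁ a₂ b o) := by
  rw [pairCount_foldK_ownRootEdge he F z heF]
  have hA := h V E ends a₁ a₂ o {b} (fun _ => ownRootAvoidCon) (F.erase e)
    (Function.update z e false) admSystem_ownRootAvoid
  have hJ := h V E ends a₁ a₂ o {b} (fun _ => ownRootAnchorCon) (F.erase e)
    (Function.update z e false) admSystem_ownRootAnchor
  have eA : (admK ends a₁ a₂ o {b} (fun _ => ownRootAvoidCon) : Config E → Config E → R) =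
      fun y w => ownRootAvoid ends a₁ a₂ b o w y := by
    funext y w; exact admK_ownRootAvoid y w
  have eJ : (admK ends a₁ a₂ o {b} (fun _ => ownRootAnchorCon) : Config E → Config E → R) =
      fun y w => ownRootAnchor ends a₁ a₂ b o w y := by
    funext y w; exact admK_ownRootAnchor y w
  rw [eA, ← pairCount_swap] at hA
  rw [eJ, ← pairCount_swap] at hJ
  linarith

/-- **The mirror**: under (TB-ADM′) the edge from the mark `o` to ITS root `a₂` never hurts either,
via the relabelling `(a₁, a₂, b, o) ↦ (a₂, a₁, o, b)` of the slack. -/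
theorem pairCount_foldK_le_ownRootEdge_of_TBAdm' [IsStrictOrderedRing R] (h : TBAdm R)
    (he : ends e = s(o, a₂)) (F : Finset E) (z : Config E) (heF : e ∈ F) :
    pairCount (F.erase e) (Function.update z e false)
        (foldK ends a₁ a₂ b o : Config E → Config E → R) ≤
      pairCount F z (foldK ends a₁ a₂ b o) := by
  classical
  have h1 := slack_eq_pairCount_foldK (R := R) ends a₁ a₂ b o F z
  have h2 := slack_eq_pairCount_foldK (R := R) ends a₁ a₂ b o (F.erase e)
    (Function.update z e false)
  have h3 := slack_eq_pairCount_foldK (R := R) ends a₂ a₁ o b F z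
  have h4 := slack_eq_pairCount_foldK (R := R) ends a₂ a₁ o b (F.erase e)
    (Function.update z e false)
  have h5 := tb14_slack_relabel (R := R) ends a₁ a₂ b o F z
  have h6 := tb14_slack_relabel (R := R) ends a₁ a₂ b o (F.erase e) (Function.update z e false)
  have hT := pairCount_foldK_le_ownRootEdge_of_TBAdm (R := R) (ends := ends) (a₁ := a₂) (a₂ := a₁)
    (b := o) (o := b) h he F z heF
  linarith

end OwnRootEdgeAdm

end TB14Cut

end Summit.Ventures.PercRepro2
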